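import Literature.MathematicalPhysics.QuantumFieldTheory.OSBumpProfileBounds
import Literature.MathematicalPhysics.QuantumFieldTheory.OSRegularisedDensity
import HarnessLib

/-!
# The base index of the analytic deconvolution: normalised bumps (towards OS II Thm. 4.1 (4.5))

Topic `Literature/MathematicalPhysics/QuantumFieldTheory`; support file for the temperedness
estimate (4.5) of Osterwalder–Schrader II, Thm. 4.1. The explicit density theorem
`OSRegularisedDensityWindow.exists_holomorphic_density_skelDist_explicit` takes an admissible index
`a₀` of mass one; here it is made explicit — the profiles are the raw bumps `χ_{r₀}` of
`OSBumpProfileBounds` and the scalar is the inverse mass — together with the two quantities entering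
the deconvolution bound:

* `baseMass_eq` — `∫ skelFamily (1, χ⃗) = c · (∫ χ_{r₀})^{k+2}` where `c` is the Jacobian constant
  of `posAff` (`∫ Φ ∘ posAff = c ∫ Φ`);
* `baseIdx` and `integral_skelFamily_baseIdx` (mass one), `norm_baseIdx_fst`
  (`= (c (∫χ_{r₀})^{k+2})⁻¹`) and `norm_baseIdx_fst_le` (`≤ (c · vol(B̄(0,r₀/2))^{k+2})⁻¹`);
* `profProd_baseIdx_le` — `profProd M ≤ (r₀^{-M} |χ₁|_M)^{k+2}` for `r₀ ≤ 1`.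

## References

* K. Osterwalder, R. Schrader, *Axioms for Euclidean Green's functions II*, Comm. Math. Phys.
  42 (1975) 281–305, Thm. 4.1 (4.5), Ch. VI.1 (6.5). [OsterwalderSchraderCMP1975]
-/

noncomputable section

open MeasureTheory Set Filter Metric
open _root_.Topology
open scoped InnerProductSpace RealInnerProductSpace SchwartzMap

namespace Literature.MathematicalPhysics.QuantumFieldTheory

open Literature.MathematicalPhysics.QuantumLattice (schwartzNorm)
open Literature.Analysis.Distribution

variable {d : ℕ} {k : ℕ} (ξ : Fin (k + 1) → EuclideanSpace ℝ (Fin d)) (ê : Fin d → EuclideanSpace ℝ (Fin d))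
  (hli : LinearIndependent ℝ ê) {r₀ : ℝ} (hr₀ : 0 < r₀)

/-- **The base profiles**: every profile the raw bump of radius `r₀`. [folklore] -/
def baseProfiles (k : ℕ) (hr₀ : 0 < r₀) : Fin (k + 2) → 𝓢(EuclideanSpace ℝ (Fin d), ℂ) := fun _ => rawBumpS hr₀

/-- The base profiles are supported in `B̄(0, r₀)`. [folklore] -/
theorem tsupport_baseProfiles (j : Fin (k + 2)) :
    tsupport (baseProfiles (d := d) k hr₀ j : EuclideanSpace ℝ (Fin d) → ℂ) ⊆ Metric.closedBall 0 r₀ :=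
  tsupport_rawBumpS_subset hr₀

/-- **The mass of the unnormalised base kernel** `∫ skelFamily (1, χ⃗)`. [folklore] -/
def baseMass (k : ℕ) (hr₀ : 0 < r₀) : ℂ := ∫ U, skelFamily (k := k) ê hli (1, baseProfiles k hr₀) U

/-- **The mass through the Jacobian constant**: `∫ skelFamily (1, χ⃗) = c (∫ χ_{r₀})^{k+2}`. [folklore] -/
theorem baseMass_eq {c : ℝ}
    (hc : ∀ Φ : (Fin (k + 2) → EuclideanSpace ℝ (Fin d)) → ℂ, ∫ U, Φ (posAff ξ ê hli U) = (c : ℂ) * ∫ y, Φ y) :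
    baseMass ê hli k hr₀ = ((c * (∫ y, osBump (V := EuclideanSpace ℝ (Fin d)) hr₀ y) ^ (k + 2) : ℝ) : ℂ) := by
  unfold baseMass
  set Φ : (Fin (k + 2) → EuclideanSpace ℝ (Fin d)) → ℂ := fun y => ∏ j, rawBumpS hr₀ (y j - pbase ξ j) with hΦ
  have h1 : (fun U => skelFamily (k := k) ê hli (1, baseProfiles k hr₀) U) = fun U => Φ (posAff ξ ê hli U) := by
    funext U
    simp only [hΦ, skelFamily_apply, baseProfiles, one_mul, posAff, Pi.add_apply, add_sub_cancel_left]
  rw [h1, hc Φ]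
  have h2 : ∫ y : Fin (k + 2) → EuclideanSpace ℝ (Fin d), ∏ j, rawBumpS hr₀ (y j - pbase ξ j) =
      ∏ j : Fin (k + 2), ∫ y : EuclideanSpace ℝ (Fin d), rawBumpS hr₀ (y - pbase ξ j) :=
    integral_fin_nat_prod_volume_eq_prod (𝕜 := ℂ) (fun j (y : EuclideanSpace ℝ (Fin d)) => rawBumpS hr₀ (y - pbase ξ j))
  rw [h2]
  have h3 : ∀ j : Fin (k + 2), ∫ y : EuclideanSpace ℝ (Fin d), rawBumpS hr₀ (y - pbase ξ j) =
      ((∫ y, osBump (V := EuclideanSpace ℝ (Fin d)) hr₀ y : ℝ) : ℂ) := fun j => by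
    rw [integral_sub_right_eq_self (fun y => rawBumpS (V := EuclideanSpace ℝ (Fin d)) hr₀ y) (pbase ξ j)]
    exact integral_rawBumpS hr₀
  simp_rw [h3]
  rw [Finset.prod_const, Finset.card_univ, Fintype.card_fin]
  push_cast
  ring

/-- The mass is a positive real number (for a positive Jacobian constant). [folklore] -/
theorem baseMass_re_pos (k : ℕ) {c : ℝ} (hc0 : 0 < c) :
    0 < c * (∫ y, osBump (V := EuclideanSpace ℝ (Fin d)) hr₀ y) ^ (k + 2) :=
  mul_pos hc0 (pow_pos (integral_osBump_pos hr₀) _)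

/-- **The base index**: scalar the inverse mass, profiles the raw bumps. [folklore] -/
def baseIdx (k : ℕ) (hr₀ : 0 < r₀) : AdmIdx k d r₀ :=
  ⟨((baseMass ê hli k hr₀)⁻¹, baseProfiles k hr₀), tsupport_baseProfiles hr₀⟩

/-- The profiles of the base index. [folklore] -/
@[simp]
theorem baseIdx_snd : (baseIdx ê hli k hr₀).1.2 = baseProfiles k hr₀ := rfl

/-- The scalar of the base index. [folklore] -/
@[simp]
theorem baseIdx_fst : (baseIdx ê hli k hr₀).1.1 = (baseMass ê hli k hr₀)⁻¹ := rfl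

/-- **The base index has mass one.** [folklore] -/
theorem integral_skelFamily_baseIdx {c : ℝ} (hc0 : 0 < c)
    (hc : ∀ Φ : (Fin (k + 2) → EuclideanSpace ℝ (Fin d)) → ℂ, ∫ U, Φ (posAff ξ ê hli U) = (c : ℂ) * ∫ y, Φ y) :
    ∫ U, skelFamily ê hli (baseIdx ê hli k hr₀).1 U = 1 := by
  have hm0 : baseMass ê hli k hr₀ ≠ 0 := by
    rw [baseMass_eq ξ ê hli hr₀ hc]
    exact_mod_cast (baseMass_re_pos hr₀ k hc0).ne'
  have h1 : ∀ U, skelFamily ê hli (baseIdx ê hli k hr₀).1 U =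
      (baseMass ê hli k hr₀)⁻¹ * skelFamily (k := k) ê hli (1, baseProfiles k hr₀) U := fun U => by
    simp only [baseIdx, skelFamily_apply, one_mul]
  simp_rw [h1]
  rw [integral_const_mul]
  exact inv_mul_cancel₀ hm0

/-- **The scalar of the base index**: `‖m⁻¹‖ = (c (∫ χ_{r₀})^{k+2})⁻¹`. [folklore] -/
theorem norm_baseIdx_fst {c : ℝ} (hc0 : 0 < c)
    (hc : ∀ Φ : (Fin (k + 2) → EuclideanSpace ℝ (Fin d)) → ℂ, ∫ U, Φ (posAff ξ ê hli U) = (c : ℂ) * ∫ y, Φ y) :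
    ‖(baseIdx ê hli k hr₀).1.1‖ = (c * (∫ y, osBump (V := EuclideanSpace ℝ (Fin d)) hr₀ y) ^ (k + 2))⁻¹ := by
  rw [baseIdx_fst, norm_inv, baseMass_eq ξ ê hli hr₀ hc, Complex.norm_real, Real.norm_eq_abs,
    abs_of_pos (baseMass_re_pos hr₀ k hc0)]

/-- **Bound of the scalar of the base index** through the volume of the inner ball:
`‖m⁻¹‖ ≤ (c · vol(B̄(0, r₀/2))^{k+2})⁻¹`. [folklore] -/
theorem norm_baseIdx_fst_le [NeZero d] {c : ℝ} (hc0 : 0 < c)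
    (hc : ∀ Φ : (Fin (k + 2) → EuclideanSpace ℝ (Fin d)) → ℂ, ∫ U, Φ (posAff ξ ê hli U) = (c : ℂ) * ∫ y, Φ y) :
    ‖(baseIdx ê hli k hr₀).1.1‖ ≤
      (c * ((volume (Metric.closedBall (0 : EuclideanSpace ℝ (Fin d)) (r₀ / 2))).toReal) ^ (k + 2))⁻¹ := by
  rw [norm_baseIdx_fst ξ ê hli hr₀ hc0 hc]
  have hv0 : 0 < (volume (Metric.closedBall (0 : EuclideanSpace ℝ (Fin d)) (r₀ / 2))).toReal :=
    ENNReal.toReal_pos (Metric.measure_closedBall_pos volume _ (by positivity)).ne' measure_closedBall_lt_top.ne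
  refine (inv_le_inv₀ (mul_pos hc0 (pow_pos (integral_osBump_pos hr₀) _)) (by positivity)).2 ?_
  exact mul_le_mul_of_nonneg_left (pow_le_pow_left₀ hv0.le (measure_le_integral_osBump hr₀) _) hc0.le

/-- **The profile product of the base index**: `profProd M = |χ_{r₀}|_M^{k+2}`. [folklore] -/
theorem profProd_baseIdx (M : ℕ) :
    profProd M (baseIdx ê hli k hr₀).1.2 = schwartzNorm M (rawBumpS (V := EuclideanSpace ℝ (Fin d)) hr₀) ^ (k + 2) := by
  rw [baseIdx_snd, profProd]
  simp only [baseProfiles, Finset.prod_const, Finset.card_univ, Fintype.card_fin]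

/-- **Bound of the profile product of the base index**: `profProd M ≤ (r₀^{-M} |χ₁|_M)^{k+2}` for
`r₀ ≤ 1`. [folklore] -/
theorem profProd_baseIdx_le [FiniteDimensional ℝ (EuclideanSpace ℝ (Fin d))] (hr1 : r₀ ≤ 1) (M : ℕ) :
    profProd M (baseIdx ê hli k hr₀).1.2 ≤
      ((r₀ ^ M)⁻¹ * schwartzNorm M (rawBumpS (V := EuclideanSpace ℝ (Fin d)) one_pos)) ^ (k + 2) := by
  rw [profProd_baseIdx]
  exact pow_le_pow_left₀ (QuantumLattice.schwartzNorm_nonneg _ _) (schwartzNorm_rawBumpS_le hr₀ hr1 M) _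

end Literature.MathematicalPhysics.QuantumFieldTheory
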